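import Summits.BirchSwinnertonDyer.BirchSwinnertonDyer.Theorems.ByReductionTypeAtTwoOrdKatoHalfAtTwoIsoZetaColemanMuIotaKatoCarriers
import Literature.NumberTheory.EllipticCurves.Kato2004.LocalIwasawaCohomologyTateDuality
import HarnessLib

/-!
# Route ByReductionTypeAtTwo, crux `OrdKatoHalfAtTwoIso` (stmt-BirchSwinnertonDyer-19573), line `steinberg-fibre-at-two`,
# F1 slot (child stmt-BirchSwinnertonDyer-24097): the W1+W3 input of the two-input door `…ZetaColemanMuIotaKatoCarriers`
# is the Literature named fact `Kato2004.exists_lambdaAdicLocalTatePairing_selmer_orthogonal` READ AT `p = 2` —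
# F1μι⁻ / the child / the crux BY NAME from that PRINT-COMPOSITE fact and the ONE memo-grade input W2 (Coleman/ERL at `2`, `Δ < 0`)

Seat `cruxlead-stmt-BirchSwinnertonDyer-19573-w3` g4 (prover WIDTH under the LEAD `cruxlead-19573`; HOME `run/shared/lean/pub/bsd-2adic/`;
`--supports` stmt-BirchSwinnertonDyer-24097). THEOREMS ONLY (no definition, no named fact, no `sorry`, no instance). HONEST FRAMING (cell
bsd-2adic): BSD is not proved by any of this; F1μι⁻ (`ZetaColemanMuIotaNegDiscAtTwo`), the child 24097 and the crux are NOT proved here —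
every theorem below is CONDITIONAL on (a) the Literature named fact `exists_lambdaAdicLocalTatePairing_selmer_orthogonal` (Tate local
duality along the cyclotomic tower + Greenberg's Kummer condition at an ordinary prime + Poitou–Tate, read on Kato's pinned carriers;
classical at every `p`, stated once for all `p`, UNDISCHARGED in the tree — `proof.conditional`) and (b) the displayed hypothesis
`hcolERL` = W2, the one memo-grade reading (Kato 12.6 / 16.6 (2) / 17.11–17.12 on the `Γ`-tower at `2` with the lead's period line
F-27a on `Δ < 0`), plus, where named, the `0 < Δ` conjunct / the print bundle / B7′ of the sibling children.

WHY. w3 g3's door `zetaColemanMuIotaNegDiscAtTwo_of_katoCarriers` (p720644) takes TWO typed inputs `hpairPT` (W1+W3) and `hcolERL`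
(W2). `hpairPT` is classical mathematics at every prime; this seat typed it as ONE Literature fact for general `p`
(`Literature/NumberTheory/EllipticCurves/Kato2004/LocalIwasawaCohomologyTateDuality.lean`), whose instance at `p = 2` is `hpairPT`
on the nose (`fun h => h 2`). So the typed residual of the F1 slot (24097 conjunct 1) is now: ONE print-composite named fact BY NAME
+ W2. Numbers: the door's displayed hypotheses shrink from two (≈ 40 lines) to one (12 lines) plus a fact name.

* `zetaColemanMuIotaNegDiscAtTwo_of_tateDuality_of_colemanERL` — fact + W2 ⇒ F1μι⁻ BY NAME.
* `ordKatoFineZetaAtTwoResidue_of_tateDuality_of_colemanERL_of_posDisc` — + the `0 < Δ` conjunct ⇒ child 24097 BY NAME.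
* `ordKatoHalfAtTwoIso_of_tateDuality_of_colemanERL_of_posDisc_of_bundle_of_B7'` — + bundle (child 23889) + B7′ (child 23921) ⇒ the
  crux BY NAME (lead g5 split door `ordKatoHalfAtTwoIso_of_iota_halves`).

References: [Kato2004Asterisque] Thm 12.6 (p. 222), Thm 16.6 (2) (p. 271), Prop 17.11 / Lemma 17.12 (pp. 277–279), §17.13 (pp. 279–280);
[MilneADT2006] I Cor. 2.3, I Thm 4.10; [GreenbergLNM1716] §2 Prop. 2.1–2.2 (pp. 72–73), §4 (8) (p. 121), p. 122; tree
`Kato2004/LocalIwasawaCohomologyTateDuality.lean` (this seat), `…ZetaColemanMuIotaKatoCarriers.lean` (w3 g3), `…PosDiscSplit.lean` (lead g5).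
-/

set_option autoImplicit false
set_option linter.dupNamespace false

noncomputable section

open scoped Classical MatrixGroups ModularForm NumberField
open CongruenceSubgroup WeierstrassCurve Field IsDedekindDomain NumberField
open Literature.NumberTheory.GaloisRepresentations
open Literature.NumberTheory.GaloisCohomology
open Literature.NumberTheory.EllipticCurves Literature.NumberTheory.EllipticCurves.ModularForms
  Literature.NumberTheory.EllipticCurves.GreenbergSelmer
open Literature.NumberTheory.EllipticCurves.Kato2004
  Literature.NumberTheory.EllipticCurves.Kato2004.EulerSystemValues
open Literature.NumberTheory.EllipticCurves.IwasawaDual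
open Literature.NumberTheory.EllipticCurves.Rank1Residual
open Literature.NumberTheory.EllipticCurves.Greenberg1999
open Summit.BirchSwinnertonDyer.Rank1Residual Summit.BirchSwinnertonDyer.Rank1Residual.X5
open Summit.BirchSwinnertonDyer.BirchSwinnertonDyer.Theorems.OrdKatoOptimalAtTwo
  Summit.BirchSwinnertonDyer.BirchSwinnertonDyer.Theorems.OrdKatoIntAtTwo
open Summit.BirchSwinnertonDyer.BirchSwinnertonDyer.Theses.ByReductionTypeAtTwo

namespace Summit.BirchSwinnertonDyer.BirchSwinnertonDyer.Theorems.SteinbergFibreAtTwo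

/-- **F1μι⁻ = `ZetaColemanMuIotaNegDiscAtTwo` BY NAME from the Literature fact «Tate local duality along the cyclotomic tower on
Kato's carriers, orthogonal to the ordinary part and to the global classes on Sel» (all `p`; instantiated at `p = 2`) and the ONE
memo-grade input W2** (`hcolERL`: a `Λ`-linear `col` on `𝐇¹_{loc,Γ}(T₂W)` with `ker col ≤ range(𝐇¹_{loc,Γ}(F⁺T) → 𝐇¹_{loc,Γ}(T))` and a
GENUINE class `g ∈ 𝐇¹_Γ` with `col (loc g) = u·M·L′`, `M ∉ (2)`, `ι L′ = C r·L₂(f, α)`, `‖r‖₂ = 1` — Kato 12.6 / 16.6 (2) / 17.11–17.12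
read on the `Γ`-tower at `2` with the period line F-27a on `Δ < 0`; NOT in print as stated). One application of w3 g3's
`zetaColemanMuIotaNegDiscAtTwo_of_katoCarriers` to `hPT 2`. CONDITIONAL; nothing closed.
[cite: MilneADT2006, Ch. I Cor. 2.3 and Thm. 4.10] [cite: GreenbergLNM1716, §2 Prop. 2.1–2.2 (pp. 72–73), §4 (8) (p. 121), p. 122]
[cite: Kato2004Asterisque, Thm 12.6 (p. 222), Thm 16.6 (2) (p. 271), Prop 17.11 and Lemma 17.12 (pp. 277–279), §17.13 (pp. 279–280)] -/
theorem zetaColemanMuIotaNegDiscAtTwo_of_tateDuality_of_colemanERL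
    (hPT : exists_lambdaAdicLocalTatePairing_selmer_orthogonal)
    (hcolERL : ∀ (W : WeierstrassCurve ℚ) [W.IsElliptic] [W.IsGloballyMinimal]
      [ContinuousSMul ℤ_[2] (W.tateModule 2)] [Module.Free ℤ_[2] (W.tateModule 2)] [Module.Finite ℤ_[2] (W.tateModule 2)]
      {N : ℕ} [NeZero N] (f : CuspForm (Gamma0 N) 2)
      (κ : ZpExtension ℚ 2) (γ : absoluteGaloisGroup ℚ) (hκ : κ.IsCyclotomic) (hγ : κ.IsTopGenerator γ),
      W.Δ < 0 → IsOrdinaryAt W 2 → W.HasSurjectiveModNGaloisRep 2 → IsCyclotomicVariable 2 γ → IsNewformOf W f →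
      ∀ (v₂ : HeightOneSpectrum (𝓞 ℚ)) (_ : ((2 : ℕ) : 𝓞 ℚ) ∈ v₂.asIdeal)
        (γᵥ : absoluteGaloisGroup (v₂.adicCompletion ℚ))
        (hsurj : Function.Surjective
          (κ.toContinuousMonoidHom.comp (resGalOfEmb (closureEmb (K := ℚ) (v₂.adicCompletion ℚ)))))
        (hγᵥ : κ.IsTopGenerator (resGalOfEmb (closureEmb (K := ℚ) (v₂.adicCompletion ℚ)) γᵥ))
        (I : IwasawaH1Data W 2 κ γ) (J : LocalIwasawaH1Data κ v₂ ((tateRep W 2).toLocal v₂) γᵥ)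
        (J' : LocalIwasawaH1Data κ v₂ (tateLocalOrdinaryRep W 2 v₂) γᵥ),
      ∃ col : J.H →ₗ[IwasawaAlgebra 2] IwasawaAlgebra 2,
        (∀ x : J.H, col x = 0 → x ∈ LinearMap.range (J'.ordinaryInclusion J)) ∧
        ∃ g : I.H, IsEulerSystemClassTwo W hκ I g ∧
          ∃ (u : (IwasawaAlgebra 2)ˣ) (M L' : IwasawaAlgebra 2) (r : ℚ_[2]),
            M ∉ IwasawaAlgebra.augIdealP 2 ∧ ‖r‖ = 1 ∧
              iwasawaToPowerSeries 2 L' = PowerSeries.C r * padicLFunction f (unitRoot W 2 : ℚ_[2]) ∧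
              col (I.loc J hsurj hγ hγᵥ g) = (u : IwasawaAlgebra 2) * M * L') :
    ZetaColemanMuIotaNegDiscAtTwo :=
  zetaColemanMuIotaNegDiscAtTwo_of_katoCarriers (hPT 2) hcolERL

/-- **The PAIR child `OrdKatoFineZetaAtTwoResidue` (stmt-BirchSwinnertonDyer-24097) BY NAME** from the Literature fact (all `p`,
read at `2`), W2, and its `0 < Δ` conjunct `OrdKatoHalfAtTwoIsoPosDisc` (RESEARCH, passed through). CONDITIONAL; nothing closed.
[cite: Kato2004Asterisque, §17.13 (pp. 279–280)] [cite: MilneADT2006, Ch. I Cor. 2.3 and Thm. 4.10]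
[cite: GreenbergLNM1716, §2 Prop. 2.2 (p. 73), p. 122] -/
theorem ordKatoFineZetaAtTwoResidue_of_tateDuality_of_colemanERL_of_posDisc
    (hPT : exists_lambdaAdicLocalTatePairing_selmer_orthogonal)
    (hcolERL : ∀ (W : WeierstrassCurve ℚ) [W.IsElliptic] [W.IsGloballyMinimal]
      [ContinuousSMul ℤ_[2] (W.tateModule 2)] [Module.Free ℤ_[2] (W.tateModule 2)] [Module.Finite ℤ_[2] (W.tateModule 2)]
      {N : ℕ} [NeZero N] (f : CuspForm (Gamma0 N) 2)
      (κ : ZpExtension ℚ 2) (γ : absoluteGaloisGroup ℚ) (hκ : κ.IsCyclotomic) (hγ : κ.IsTopGenerator γ),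
      W.Δ < 0 → IsOrdinaryAt W 2 → W.HasSurjectiveModNGaloisRep 2 → IsCyclotomicVariable 2 γ → IsNewformOf W f →
      ∀ (v₂ : HeightOneSpectrum (𝓞 ℚ)) (_ : ((2 : ℕ) : 𝓞 ℚ) ∈ v₂.asIdeal)
        (γᵥ : absoluteGaloisGroup (v₂.adicCompletion ℚ))
        (hsurj : Function.Surjective
          (κ.toContinuousMonoidHom.comp (resGalOfEmb (closureEmb (K := ℚ) (v₂.adicCompletion ℚ)))))
        (hγᵥ : κ.IsTopGenerator (resGalOfEmb (closureEmb (K := ℚ) (v₂.adicCompletion ℚ)) γᵥ))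
        (I : IwasawaH1Data W 2 κ γ) (J : LocalIwasawaH1Data κ v₂ ((tateRep W 2).toLocal v₂) γᵥ)
        (J' : LocalIwasawaH1Data κ v₂ (tateLocalOrdinaryRep W 2 v₂) γᵥ),
      ∃ col : J.H →ₗ[IwasawaAlgebra 2] IwasawaAlgebra 2,
        (∀ x : J.H, col x = 0 → x ∈ LinearMap.range (J'.ordinaryInclusion J)) ∧
        ∃ g : I.H, IsEulerSystemClassTwo W hκ I g ∧
          ∃ (u : (IwasawaAlgebra 2)ˣ) (M L' : IwasawaAlgebra 2) (r : ℚ_[2]),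
            M ∉ IwasawaAlgebra.augIdealP 2 ∧ ‖r‖ = 1 ∧
              iwasawaToPowerSeries 2 L' = PowerSeries.C r * padicLFunction f (unitRoot W 2 : ℚ_[2]) ∧
              col (I.loc J hsurj hγ hγᵥ g) = (u : IwasawaAlgebra 2) * M * L')
    (hPos : OrdKatoHalfAtTwoIsoPosDisc) : OrdKatoFineZetaAtTwoResidue :=
  ⟨zetaColemanMuIotaNegDiscAtTwo_of_tateDuality_of_colemanERL hPT hcolERL, hPos⟩

/-- **The crux `OrdKatoHalfAtTwoIso` (stmt-BirchSwinnertonDyer-19573) BY NAME** from the Literature fact (all `p`, read at `2`),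
W2, the `0 < Δ` conjunct (child 24097.2), the print bundle (child 23889: PUB ∧ Abbes–Ullmo ∧ Greenberg 5.14 at `2`) and B7′
(child 23921) — one application of the lead g5's split door `ordKatoHalfAtTwoIso_of_iota_halves`. CONDITIONAL; nothing closed.
[cite: Kato2004Asterisque, Thm 17.4 (1)(2) (p. 273) and §17.13 (pp. 279–280)] [cite: GreenbergLNM1716, Prop. 5.14 (p. 130)]
[cite: AbbesUllmo1996, Thm. A] -/
theorem ordKatoHalfAtTwoIso_of_tateDuality_of_colemanERL_of_posDisc_of_bundle_of_B7'
    (hPT : exists_lambdaAdicLocalTatePairing_selmer_orthogonal)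
    (hcolERL : ∀ (W : WeierstrassCurve ℚ) [W.IsElliptic] [W.IsGloballyMinimal]
      [ContinuousSMul ℤ_[2] (W.tateModule 2)] [Module.Free ℤ_[2] (W.tateModule 2)] [Module.Finite ℤ_[2] (W.tateModule 2)]
      {N : ℕ} [NeZero N] (f : CuspForm (Gamma0 N) 2)
      (κ : ZpExtension ℚ 2) (γ : absoluteGaloisGroup ℚ) (hκ : κ.IsCyclotomic) (hγ : κ.IsTopGenerator γ),
      W.Δ < 0 → IsOrdinaryAt W 2 → W.HasSurjectiveModNGaloisRep 2 → IsCyclotomicVariable 2 γ → IsNewformOf W f →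
      ∀ (v₂ : HeightOneSpectrum (𝓞 ℚ)) (_ : ((2 : ℕ) : 𝓞 ℚ) ∈ v₂.asIdeal)
        (γᵥ : absoluteGaloisGroup (v₂.adicCompletion ℚ))
        (hsurj : Function.Surjective
          (κ.toContinuousMonoidHom.comp (resGalOfEmb (closureEmb (K := ℚ) (v₂.adicCompletion ℚ)))))
        (hγᵥ : κ.IsTopGenerator (resGalOfEmb (closureEmb (K := ℚ) (v₂.adicCompletion ℚ)) γᵥ))
        (I : IwasawaH1Data W 2 κ γ) (J : LocalIwasawaH1Data κ v₂ ((tateRep W 2).toLocal v₂) γᵥ)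
        (J' : LocalIwasawaH1Data κ v₂ (tateLocalOrdinaryRep W 2 v₂) γᵥ),
      ∃ col : J.H →ₗ[IwasawaAlgebra 2] IwasawaAlgebra 2,
        (∀ x : J.H, col x = 0 → x ∈ LinearMap.range (J'.ordinaryInclusion J)) ∧
        ∃ g : I.H, IsEulerSystemClassTwo W hκ I g ∧
          ∃ (u : (IwasawaAlgebra 2)ˣ) (M L' : IwasawaAlgebra 2) (r : ℚ_[2]),
            M ∉ IwasawaAlgebra.augIdealP 2 ∧ ‖r‖ = 1 ∧
              iwasawaToPowerSeries 2 L' = PowerSeries.C r * padicLFunction f (unitRoot W 2 : ℚ_[2]) ∧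
              col (I.loc J hsurj hγ hγᵥ g) = (u : IwasawaAlgebra 2) * M * L')
    (hPos : OrdKatoHalfAtTwoIsoPosDisc)
    (hbundle : OrdPublishedInputsAtTwo ∧ abbesUllmo_not_dvd_maninConstant_of_not_dvd_level ∧
      Greenberg1999.prop514_isTorsion_mu_eq_zero_two)
    (hB7' : KatoMuPartOff514AtOptimalMemberOfNotSurjectiveTwo) : OrdKatoHalfAtTwoIso :=
  ordKatoHalfAtTwoIso_of_iota_halves (zetaColemanMuIotaNegDiscAtTwo_of_tateDuality_of_colemanERL hPT hcolERL) hPos hbundle hB7'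

end Summit.BirchSwinnertonDyer.BirchSwinnertonDyer.Theorems.SteinbergFibreAtTwo

end
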